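import Summits.CriticalPhenomena.Ising3DConformalLimit.Theses.PrecisionLaplacian

/-!
# Disproof of `InverseMFerromagnet` (crux r2 of route PrecisionLaplacian, item stmt-CriticalPhenomena-4798) — work file

Standing adversary's Lean record (refuter-cdisprove-stmt-CriticalPhenomena-4798-0).  Prose lives in
docstrings only.  Everything here is `lean check`ed and sorry-free unless marked NEAR-MISS.  Index:

* `corrMatrix`, `inverseM_iff` — the crux restated through a named matrix `Σ = (⟨σ_pσ_q⟩)`.
* (a) LOAD-BEARING HYPOTHESES (theorems `…_false_without_…`):
  * `WithoutNonneg` / `inverseM_false_without_nonneg` — dropping `0 ≤ K i` is fatal at `n = 2`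
    (one antiferromagnetic bond).  Any proof must use ferromagnetism.
  * `WithoutPair` / `inverseM_false_without_pair` — keeping `K ≥ 0` and evenness (zero field) but
    allowing ONE four-body term is fatal at `n = 4` (path `0–1–2` plus `σ₀σ₁σ₂σ₃`, all couplings
    `log 2`; `(Σ⁻¹)₁₃ = 3375/12304 > 0`).  Hence NO argument valid for general even ferromagnets
    (GKS I/II, Ginibre, Kelly–Sherman, FKG/association) can prove IM: the pair structure
    `E[σ_x | rest] = tanh(linear form)` must enter.  (Numerically 65–70 % of random even
    ferromagnets with 4-body terms violate IM; `py/evenferro.py` in the refuter folder.)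
* (b₀) POSITIVE STRUCTURE (helper lemmas, evidence for provers): `corrMatrix_posDef` (Σ ≻ 0 for
  every `n, K, C` — no sign hypothesis needed), `corrMatrix_det_pos`, `corrMatrix_entry_gks`
  (`Σ_{pr}Σ_{rq} ≤ Σ_{pq}`, GKS II), `inverseM_two`, `inverseM_three`, `inverseM_of_le_three` (the crux HOLDS for `n ≤ 3`),
  `inverseM_tight_at_twoSeparator` (the bound `0` is attained across a 2-separator).
* (c) REFUTED NATURAL STRENGTHENING: `PrecisionAntitone` (entries of `Σ⁻¹` antitone in every
  coupling — which would prove IM by integrating from `K = 0`) is FALSE: `not_precisionAntitone`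
  (`K₄` minus a bond, couplings `log 2`; switching the missing bond on with coupling `log 4`
  RAISES `(Σ⁻¹)₂₃` from `-55815/18496` to `-290505/98192`).  True for `n ≤ 3`.
* (d) STRUCTURE FOUND (docstrings of `CubicPredictorLaw`, `TriplePartialCovLaw`; no proof and no
  counterexample — these are the distilled open cores):
  * IM on a pair `(x,y)` with `deg y = 3`, `x ∉ ∂y` is EQUIVALENT to the sign law
    `c_x(∂y) ≤ 0` for the best linear predictor of the cubic `σ_{∂y}` in the decimated pair model
    (star–triangle), and conversely every violation of the law yields an IM violation one vertex
    larger.  Leading high-temperature order of the law = Lebowitz inequality `u₄ ≤ 0`: IM is a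
    "matrix-dressed Lebowitz inequality".  0 violations in 17 643 random instances (|T| = 3 and 5).
  * general `(x,y)`, `x ≁ y`: `Σ_{xy·rest} = Σ_{S,S'} κˣ_S κʸ_{S'} PCov(σ_S, σ_{S'})` with `κ` the
    odd Walsh coefficients of `tanh(Σ Kᵢsᵢ)` over the neighbours; `κ_{ijk} < 0` unless a strong
    spectator bond (`tanh² D > 1/3`) is present, when `κ_{123} > 0` (max `(2/3)K³` at
    `tanh² D = 2/3`).  This is the only sign-indefinite mechanism found; in the isolated-star limit
    it cancels EXACTLY against the restoring terms through the identity
    `tanh⁽³⁾ + 3 tanh · tanh⁽²⁾ = -2 tanh⁽¹⁾`, leaving the margin `-2K₁K₂K₃(1-T²) < 0`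
    (observed ratio favouring/restoring 0.49 at `T² = 0.69`; predicted `(6T²-2)/(6T²) = 0.52`).
  * 2-cut gluing: `(Σ⁻¹)_{xy} = 0` across a 2-separator; the first-order effect of a weak bridge is
    `-t_X t_Y (1-m²)` with both `t`'s instances of the same law ⇒ cannot create a violation.
  * cylinders `C_w × C_L`, `P_w × C_L` (w = 3,4, L ≤ 12, 49 coupling pairs each): all entries `< 0`
    including the exponentially small far field; for `C_w × ℤ` the far-field sign is governed by
    the largest zero of `ŝ_q(z) = Σ_m a_m (λ_m/(z-λ_m) - λ_m⁻¹/(z-λ_m⁻¹))` over transverse momenta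
    `q`; its zeros are real and interlace the odd-sector transfer eigenvalues (Pick function in
    `u = z + 1/z`); the dominant one sits in the `q = 0` three-fermion gap with negative residue.
* THETA LAW (high-temperature far field, new): for `x ≁ y`,
  `(Σ⁻¹)_{xy} = -4 · N_θ · t^{L_θ} + O(t^{L_θ+1})`, `L_θ` = minimal total length of THREE internally
  vertex-disjoint `x–y` paths, `N_θ` = number of minimising triples (`t = tanh K` uniform).  Verified on
  `K_{2,3}` (-4t⁶), `K_{2,4}` (-16t⁶), `K_{2,5}` (-40t⁶), θ(3,3,3) (-4t⁹), θ(2,4,4) (-4t¹⁰), wheel `W₅`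
  (-4t⁷), cube `Q₃` (-8t⁹ antipodal, -8t⁸ at distance 2), Petersen (-4t⁸), and it reproduces all four
  `ℤ³` classes of the previous refuter's series ((110) -16t⁸, (111) -8t⁹, (200) -24t¹⁰, nn -t).
  By Menger "no theta ⇔ a 2-separator", matching the exact zeros; the leading far-field coefficient is
  NEGATIVE on every finite graph, so IM cannot fail perturbatively in `t`.  Field-theory reading:
  `Σ⁻¹ = Γ⁽²⁾` and the first non-local self-energy diagram of a `ℤ₂`-symmetric theory is the sunset
  `∝ -G(x,y)³`.
* q-DEFORMATION (barrier-type finding): let `IM(q)` say that the FK(q) random-cluster connectivity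
  matrix `T_q(x,y) = P_q(x ↔ y)` is inverse-M (`T_2 = Σ`).  Exact enumeration (n ≤ 7, ≤ 14 bonds):
  `IM(q)` FAILS for q = 0.5, 1 (Bernoulli percolation: 70 % of instances), 1.2, …, 1.99 and holds in
  every instance for q = 2, 2.5, 3, 4.  On 2-separated pairs the entry crosses `0` exactly at `q = 2`,
  linearly in `q - 2` (the Ising exact zeros are a `q = 2` identity); 3-connected pairs have thresholds
  `q* < 2` (e.g. 1.97).  So Ising sits exactly on the boundary `sup q* = 2`: no argument valid for
  general random-cluster measures (FKG, monotone coupling, domination — all `q ≥ 1`) proves IM; the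
  spin structure specific to `q = 2` (switching lemma / linear two-spin conditional expectations) must
  enter.  Natural generalisation suggested: `IM(q)` for all `q ≥ 2`.
* 2D tori `C_6×C_12`, `C_7×C_15`, `C_8×C_16` through `β_c`: all entries `< 0` (transfer matrix, local).
* 3D SLABS (farm j006663, transfer operator on 2¹⁶ states, self-tested against brute force): `C₃×C₃×P₁₂`,
  `C₃×C₄×P₁₂`, `C₄×C₄×P₁₂`, `C₄×C₄×P₁₆` at `K ∈ {0.15,…,0.26} ∋ β_c(3) = 0.22165`, and 2D cylinders
  `C₁₀×P₂₀`, `C₁₂×P₁₆` around `β_c(2)`: 22 cases, n ≤ 256, ZERO positive entries; far profiles negative at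
  every distance (e.g. `4×4×16` at `β_c`: -1.6e-4, -3.5e-5, …, -6.8e-10 at `dr = 7`).
* DEGENERATION STRUCTURE of the zero set: besides 2-separators (bond → 0), entries also vanish in
  CONTRACTION limits (bond → ∞ merging sites so that the contracted graph acquires a 2-separator);
  every local/farm optimiser run converges to one of these two degenerations (theta-restricted local
  ascent, n ≤ 9: best +2e-12 with K ∈ [0.01,2], +3e-14 with K ∈ [0.15,2], -4e-10 with K ∈ [0.15,0.8]).
* (e) SEARCH LOG: farm job j013717 (4 cores × 0.38 h): 1 604 494 ascent evaluations in 14 834 stochastic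
  ascents over 36 (topology family × coupling law) ensembles, n ≤ 17 (Erdős–Rényi, random 3/4/5-regular,
  2D/3D grids incl. diagonals and triangular patches, named cubic graphs — Petersen, Heawood, Q₃, Q₄, K₃₃,
  K₄₄, prisms, Möbius ladders, wheels, thetas —, planted spectator motifs; uniform/log-uniform/bimodal/
  near-critical/degree-scaled/spectator couplings in [0.002, 2.5]), objective = max normalised entry
  over theta-connected non-adjacent pairs with `λ_min(Σ) ≥ 1e-8`: best float value +2.8e-8 (= the guard's
  noise floor), all 30 mpmath rechecks `≤ 0` on theta pairs (−1e-11 … −1e-21): ZERO violations; j013721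
  (same search, 5.5 h, tag long) queued — its summary auto-attaches to the item.  Earlier: jobs j013717/j013721 (n ≤ 17, six topology ensembles × six coupling laws, stochastic
  ascent on theta-connected pairs with conditioning guard, mpmath recheck; smoke j005255: 1.9·10⁵
  evaluations, every float maximum an exact-zero pair) and j006663 (3D slabs `C₄×C₄×P_L` by transfer
  operator) — summaries auto-attach to the item; local gadget/optimiser searches
  (~4·10⁴ evaluations, exact rational rechecks): 0 violations; previous refuters: 8.8·10⁵ random
  instances n ≤ 8, farm j000831 (n ≤ 11), ℤ³ high-temperature series to t¹¹ — 0 violations.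
-/

namespace Summit.CriticalPhenomena.Ising3DConformalLimit.Cruxes.InverseMFerromagnet.Disproof

open Literature.Probability.LatticeModels Finset
open Summit.CriticalPhenomena.Ising3DConformalLimit.Theses.PrecisionLaplacian
open scoped symmDiff

noncomputable section

/-- The spin second-moment matrix `Σ_{pq} = ⟨σ_p σ_q⟩` of the crux (zero field, couplings `K` on
the sets `C i`). [folklore] -/
def corrMatrix (n m : ℕ) (K : Fin m → ℝ) (C : Fin m → Finset (Fin n)) : Matrix (Fin n) (Fin n) ℝ :=
  Matrix.of fun (p q : Fin n) => gksExpect Finset.univ K C (fun ω => spinAt p ω * spinAt q ω)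

/-- The crux, read through `corrMatrix` (definitional). [folklore] -/
theorem inverseM_iff :
    InverseMFerromagnet ↔ ∀ (n m : ℕ) (K : Fin m → ℝ) (C : Fin m → Finset (Fin n)),
      (∀ i, 0 ≤ K i) → (∀ i, (C i).card = 2) → ∀ x y : Fin n, x ≠ y → (corrMatrix n m K C)⁻¹ x y ≤ 0 :=
  Iff.rfl

/-! ## (a) Load-bearing hypothesis: ferromagnetism `0 ≤ K i` -/

/-- The crux with the sign hypothesis `∀ i, 0 ≤ K i` dropped (load-bearing analysis). [folklore] -/
def WithoutNonneg : Prop :=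
  ∀ (n m : ℕ) (K : Fin m → ℝ) (C : Fin m → Finset (Fin n)),
    (∀ i, (C i).card = 2) → ∀ x y : Fin n, x ≠ y → (corrMatrix n m K C)⁻¹ x y ≤ 0

section TwoSpins

/-- The bond variable `σ₀σ₁` on two sites. -/
private def bond (ω : SpinConfig (Fin 2)) : ℝ := spinAt 0 ω * spinAt 1 ω

/-- A spin is `1` or `-1`. [folklore] -/
private lemma spinAt_eq_one_or {V : Type*} (x : V) (ω : SpinConfig V) :
    spinAt x ω = 1 ∨ spinAt x ω = -1 := by
  rcases Int.units_eq_one_or (ω x) with h | h <;> simp [spinAt, h]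

/-- The bond variable is `1` or `-1`. [folklore] -/
private lemma bond_eq_one_or (ω : SpinConfig (Fin 2)) : bond ω = 1 ∨ bond ω = -1 := by
  rcases spinAt_eq_one_or (0 : Fin 2) ω with h0 | h0 <;>
    rcases spinAt_eq_one_or (1 : Fin 2) ω with h1 | h1 <;> simp [bond, h0, h1]

/-- Flip the spin at site `0`. -/
private def flip0 (ω : SpinConfig (Fin 2)) : SpinConfig (Fin 2) :=
  fun x => if x = 0 then -ω x else ω x

/-- Flipping site `0` twice is the identity. [folklore] -/
private lemma flip0_involutive : Function.Involutive flip0 := by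
  intro ω; funext x; by_cases hx : x = 0 <;> simp [flip0, hx]

/-- Flipping site `0` negates the bond variable. [folklore] -/
private lemma bond_flip0 (ω : SpinConfig (Fin 2)) : bond (flip0 ω) = -bond ω := by
  simp [bond, flip0, spinAt, Units.val_neg]

/-- The antiferromagnetic two-spin system: `K ≡ -1` on the single bond `{0,1}`. -/
private def Kaf : Fin 1 → ℝ := fun _ => -1
/-- The single bond `{0,1}` (as `univ`) of the two-spin witness. [folklore] -/
private def Caf : Fin 1 → Finset (Fin 2) := fun _ => Finset.univ

/-- Boltzmann weight of the two-spin witness: `e^{-σ₀σ₁}`. [folklore] -/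
private lemma weight_eq (ω : SpinConfig (Fin 2)) :
    gksWeight Finset.univ Kaf Caf ω = Real.exp (-bond ω) := by
  simp [gksWeight, gksHamiltonian, Kaf, Caf, spinProduct, Fin.prod_univ_two, bond]

/-- numerator `Z⟨σ₀σ₁⟩ = ∑ b e^{-b}` is negative (pair `ω` with its flip). -/
private lemma num_neg : gksSum Finset.univ Kaf Caf bond < 0 := by
  have hsum : gksSum Finset.univ Kaf Caf bond
      = ∑ ω : SpinConfig (Fin 2), bond (flip0 ω) * Real.exp (-bond (flip0 ω)) := by
    unfold gksSum
    simp_rw [weight_eq]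
    exact (Equiv.sum_comp flip0_involutive.toPerm (fun ω => bond ω * Real.exp (-bond ω))).symm
  have h2 : 2 * gksSum Finset.univ Kaf Caf bond
      = ∑ ω : SpinConfig (Fin 2), bond ω * (Real.exp (-bond ω) - Real.exp (bond ω)) := by
    rw [two_mul]
    nth_rewrite 2 [hsum]
    unfold gksSum
    simp_rw [weight_eq, bond_flip0, neg_neg, ← Finset.sum_add_distrib]
    refine Finset.sum_congr rfl fun ω _ => by ring
  have hneg : ∑ ω : SpinConfig (Fin 2), bond ω * (Real.exp (-bond ω) - Real.exp (bond ω)) < 0 := by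
    apply Finset.sum_neg
    · intro ω _
      rcases bond_eq_one_or ω with h | h <;> rw [h]
      · have : Real.exp (-1) < Real.exp 1 := Real.exp_lt_exp.mpr (by norm_num)
        linarith
      · have : Real.exp (-1) < Real.exp 1 := Real.exp_lt_exp.mpr (by norm_num)
        simp only [neg_neg]
        linarith
    · exact Finset.univ_nonempty
  linarith

/-- `Z⟨σ₀σ₁⟩ > -Z`, i.e. `⟨σ₀σ₁⟩ > -1`. -/
private lemma num_gt_neg_den :
    -gksSum Finset.univ Kaf Caf (fun _ => 1) < gksSum Finset.univ Kaf Caf bond := by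
  have h : 0 < gksSum Finset.univ Kaf Caf bond + gksSum Finset.univ Kaf Caf (fun _ => 1) := by
    unfold gksSum
    rw [← Finset.sum_add_distrib]
    apply Finset.sum_pos'
    · intro ω _
      have hw := (gksWeight_pos Finset.univ Kaf Caf ω).le
      rcases bond_eq_one_or ω with hb | hb <;> rw [hb] <;> nlinarith
    · refine ⟨fun _ => 1, Finset.mem_univ _, ?_⟩
      have hw := gksWeight_pos Finset.univ Kaf Caf (fun _ => 1)
      have hb : bond (fun _ => 1) = 1 := by simp [bond, spinAt]
      rw [hb]; nlinarith
  linarith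

/-- `c = ⟨σ₀σ₁⟩` of the antiferromagnetic pair. -/
private def caf : ℝ := gksExpect Finset.univ Kaf Caf bond

/-- `⟨σ₀σ₁⟩ < 0` for the antiferromagnetic pair. [folklore] -/
private lemma caf_neg : caf < 0 :=
  div_neg_of_neg_of_pos num_neg (gksSum_one_pos _ _ _)

/-- `-1 < ⟨σ₀σ₁⟩` for the antiferromagnetic pair. [folklore] -/
private lemma neg_one_lt_caf : -1 < caf := by
  unfold caf gksExpect
  rw [lt_div_iff₀ (gksSum_one_pos _ _ _)]
  simpa using num_gt_neg_den

/-- `Σ = !![1, c; c, 1]` for the two-spin witness. [folklore] -/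
private lemma corrMatrix_two : corrMatrix 2 1 Kaf Caf = !![1, caf; caf, 1] := by
  ext p q
  fin_cases p <;> fin_cases q
  · simp [corrMatrix, spinAt_mul_self, gksExpect, (gksSum_one_pos _ _ _).ne']
  · simp only [corrMatrix, Matrix.of_apply]
    rfl
  · simp only [corrMatrix, Matrix.of_apply, caf]
    show gksExpect _ _ _ _ = gksExpect _ _ _ _
    congr 1
    funext ω
    simp only [bond]
    exact mul_comm _ _
  · simp [corrMatrix, spinAt_mul_self, gksExpect, (gksSum_one_pos _ _ _).ne']

/-- The witness entry: `(Σ⁻¹)₀₁ = -c/(1-c²) > 0` for `c = ⟨σ₀σ₁⟩ ∈ (-1, 0)`. -/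
private lemma inv_entry_pos : 0 < (corrMatrix 2 1 Kaf Caf)⁻¹ 0 1 := by
  have hneg : caf < 0 := caf_neg
  have hgt : -1 < caf := neg_one_lt_caf
  have hdet : (!![1, caf; caf, 1] : Matrix (Fin 2) (Fin 2) ℝ).det = 1 - caf * caf := by
    rw [Matrix.det_fin_two]; simp
  have hdpos : 0 < 1 - caf * caf := by nlinarith
  rw [corrMatrix_two, Matrix.inv_def, hdet, Matrix.adjugate_fin_two, Ring.inverse_eq_inv']
  simp
  have : 0 < (1 - caf * caf)⁻¹ := inv_pos.mpr hdpos
  nlinarith [mul_pos this (neg_pos.mpr hneg)]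

end TwoSpins

/-- **Any proof must use `0 ≤ K i`.**  With one antiferromagnetic bond (`n = 2`, `K ≡ -1`,
`C ≡ {0,1}`) the correlation matrix is `!![1, c; c, 1]` with `c = -tanh 1 < 0`, whose inverse has
off-diagonal entry `-c/(1-c²) > 0`. [folklore] -/
theorem inverseM_false_without_nonneg : ¬ WithoutNonneg := by
  intro h
  have h01 := h 2 1 Kaf Caf (by intro i; simp [Caf]) 0 1 (by decide)
  exact absurd h01 (not_le.mpr inv_entry_pos)

/-! ## (b₀) Positive structure every attack runs into (helper lemmas for provers; evidence only)

`Σ` is positive definite (so `Matrix.inv` in the crux is the genuine inverse and `det Σ > 0`), and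
the crux HOLDS on three sites by GKS II — the smallest carrier of a counterexample is `n = 4`, and by
the 2-separator zeros (F-ii of the route-review refuter) in fact needs a pair joined by three
internally disjoint paths. -/

section Positive

variable {Λ ι : Type*} [Fintype Λ] [DecidableEq Λ] (s : Finset ι) (K : ι → ℝ) (C : ι → Finset Λ)

/-- `⟨·⟩` is additive over finite sums. [folklore] -/
lemma gksExpect_finset_sum {α : Type*} (S : Finset α) (g : α → SpinConfig Λ → ℝ) :
    gksExpect s K C (fun ω => ∑ a ∈ S, g a ω) = ∑ a ∈ S, gksExpect s K C (g a) := by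
  unfold gksExpect gksSum
  rw [← Finset.sum_div]
  congr 1
  simp_rw [Finset.sum_mul]
  rw [Finset.sum_comm]

/-- `⟨c f⟩ = c ⟨f⟩`. [folklore] -/
lemma gksExpect_const_mul (c : ℝ) (f : SpinConfig Λ → ℝ) :
    gksExpect s K C (fun ω => c * f ω) = c * gksExpect s K C f := by
  unfold gksExpect gksSum
  simp_rw [mul_assoc]
  rw [← Finset.mul_sum, mul_div_assoc]

/-- `⟨f⟩ > 0` for a nonnegative `f` that is positive somewhere. [folklore] -/
lemma gksExpect_pos_of_nonneg {f : SpinConfig Λ → ℝ} (hf : ∀ ω, 0 ≤ f ω) (ω₀ : SpinConfig Λ)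
    (h0 : 0 < f ω₀) : 0 < gksExpect s K C f := by
  unfold gksExpect
  refine div_pos ?_ (gksSum_one_pos s K C)
  unfold gksSum
  apply Finset.sum_pos'
  · intro ω _; exact mul_nonneg (hf ω) (gksWeight_pos s K C ω).le
  · exact ⟨ω₀, Finset.mem_univ _, mul_pos h0 (gksWeight_pos s K C ω₀)⟩

variable {n m : ℕ} (Kf : Fin m → ℝ) (Cf : Fin m → Finset (Fin n))

/-- The quadratic form of `Σ` is the second moment of the linear spin functional `∑ v_p σ_p`. [folklore] -/
lemma corrMatrix_quadForm (v : Fin n → ℝ) :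
    dotProduct v ((corrMatrix n m Kf Cf).mulVec v) =
      gksExpect Finset.univ Kf Cf (fun ω => (∑ p, v p * spinAt p ω) ^ 2) := by
  have hsq : (fun ω : SpinConfig (Fin n) => (∑ p, v p * spinAt p ω) ^ 2)
      = fun ω => ∑ p, ∑ q, (v p * v q) * (spinAt p ω * spinAt q ω) := by
    funext ω
    rw [sq, Finset.sum_mul_sum]
    refine Finset.sum_congr rfl fun p _ => Finset.sum_congr rfl fun q _ => by ring
  rw [hsq, gksExpect_finset_sum]
  simp only [dotProduct, Matrix.mulVec, corrMatrix, Matrix.of_apply]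
  refine Finset.sum_congr rfl fun p _ => ?_
  rw [gksExpect_finset_sum, Finset.mul_sum]
  refine Finset.sum_congr rfl fun q _ => ?_
  rw [gksExpect_const_mul]
  ring

/-- **`Σ` is positive definite** (so `Matrix.inv` in the crux is the genuine inverse): `vᵀΣv =
⟨(∑ v_pσ_p)²⟩ > 0` for `v ≠ 0`, testing on the configuration `σ_p = sign v_p`. [folklore] -/
theorem corrMatrix_posDef : (corrMatrix n m Kf Cf).PosDef := by
  rw [Matrix.posDef_iff_dotProduct_mulVec]
  refine ⟨?_, fun v hv => ?_⟩
  · refine Matrix.IsHermitian.ext fun p q => ?_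
    simp only [corrMatrix, Matrix.of_apply, star_trivial]
    exact congrArg _ (funext fun ω => mul_comm _ _)
  · simp only [star_trivial]
    rw [corrMatrix_quadForm]
    -- test configuration
    let ω₀ : SpinConfig (Fin n) := fun p => if 0 ≤ v p then 1 else -1
    have hterm : ∀ p, v p * spinAt p ω₀ = |v p| := by
      intro p
      by_cases hp : 0 ≤ v p
      · simp [ω₀, spinAt, hp, abs_of_nonneg hp]
      · simp [ω₀, spinAt, hp, abs_of_neg (lt_of_not_ge hp)]
    refine gksExpect_pos_of_nonneg _ _ _ (fun ω => sq_nonneg _) ω₀ ?_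
    simp_rw [hterm]
    obtain ⟨p, hp⟩ : ∃ p, v p ≠ 0 := by
      by_contra hall
      push Not at hall
      exact hv (funext hall)
    have : 0 < ∑ q, |v q| :=
      Finset.sum_pos' (fun q _ => abs_nonneg _) ⟨p, Finset.mem_univ _, abs_pos.mpr hp⟩
    positivity

/-- `det Σ > 0`. [folklore] -/
theorem corrMatrix_det_pos : 0 < (corrMatrix n m Kf Cf).det :=
  (corrMatrix_posDef Kf Cf).det_pos

/-- diagonal entries of `Σ` are `1`. [folklore] -/
lemma corrMatrix_diag (p : Fin n) : corrMatrix n m Kf Cf p p = 1 := by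
  simp [corrMatrix, spinAt_mul_self, gksExpect, (gksSum_one_pos _ _ _).ne']

/-- off-diagonal entries of `Σ` are the GKS pair expectations `⟨σ_{ {p,q} }⟩`. [folklore] -/
lemma corrMatrix_offdiag {p q : Fin n} (h : p ≠ q) :
    corrMatrix n m Kf Cf p q = gksExpect Finset.univ Kf Cf (spinProduct {p, q}) := by
  simp only [corrMatrix, Matrix.of_apply]
  congr 1
  funext ω
  simp [spinProduct, Finset.prod_pair h]

/-- GKS II for matrix entries: `Σ_{pr} Σ_{rq} ≤ Σ_{pq}` for distinct `p,q,r`. [folklore] -/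
lemma corrMatrix_entry_gks (hK : ∀ i, 0 ≤ Kf i) {p q r : Fin n} (hpq : p ≠ q) (hpr : p ≠ r)
    (hrq : r ≠ q) :
    corrMatrix n m Kf Cf p r * corrMatrix n m Kf Cf r q ≤ corrMatrix n m Kf Cf p q := by
  rw [corrMatrix_offdiag Kf Cf hpr, corrMatrix_offdiag Kf Cf hrq, corrMatrix_offdiag Kf Cf hpq]
  have h := gksExpect_mul_gksExpect_le Finset.univ Kf Cf (fun i _ => hK i) {p, r} {r, q}
  have hsd : ({p, r} : Finset (Fin n)) ∆ {r, q} = {p, q} := by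
    ext x
    simp only [Finset.mem_symmDiff, Finset.mem_insert, Finset.mem_singleton]
    constructor
    · rintro (⟨h1 | h1, h2⟩ | ⟨h1 | h1, h2⟩) <;> simp_all
    · rintro (rfl | rfl)
      · left; exact ⟨Or.inl rfl, fun h => h.elim (fun h => hpr h) (fun h => hpq h)⟩
      · right; exact ⟨Or.inr rfl, fun h => h.elim (fun h => hpq h.symm) (fun h => hrq h.symm)⟩
  rw [hsd] at h
  exact h

/-- symmetry of `Σ`. [folklore] -/
lemma corrMatrix_symm (p q : Fin n) : corrMatrix n m Kf Cf p q = corrMatrix n m Kf Cf q p := by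
  simp only [corrMatrix, Matrix.of_apply]
  exact congrArg _ (funext fun ω => mul_comm _ _)

/-- **The crux holds on three sites** (`n = 3`, any number of bonds): `(Σ⁻¹)_{xy} =
-(Σ_{xy} - Σ_{xz}Σ_{zy})/det Σ ≤ 0` by GKS II and `det Σ > 0`. [folklore] -/
theorem inverseM_three (Kf : Fin m → ℝ) (Cf : Fin m → Finset (Fin 3)) (hK : ∀ i, 0 ≤ Kf i)
    (x y : Fin 3) (hxy : x ≠ y) : (corrMatrix 3 m Kf Cf)⁻¹ x y ≤ 0 := by
  have hdet := corrMatrix_det_pos Kf Cf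
  have hdinv : 0 ≤ ((corrMatrix 3 m Kf Cf).det)⁻¹ := (inv_pos.mpr hdet).le
  set A := corrMatrix 3 m Kf Cf with hA
  have d0 := corrMatrix_diag Kf Cf (0 : Fin 3)
  have d1 := corrMatrix_diag Kf Cf (1 : Fin 3)
  have d2 := corrMatrix_diag Kf Cf (2 : Fin 3)
  have s10 := corrMatrix_symm Kf Cf (1 : Fin 3) 0
  have s20 := corrMatrix_symm Kf Cf (2 : Fin 3) 0
  have s21 := corrMatrix_symm Kf Cf (2 : Fin 3) 1
  have g01 := corrMatrix_entry_gks Kf Cf hK (p := (0 : Fin 3)) (q := 1) (r := 2) (by decide) (by decide) (by decide)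
  have g02 := corrMatrix_entry_gks Kf Cf hK (p := (0 : Fin 3)) (q := 2) (r := 1) (by decide) (by decide) (by decide)
  have g12 := corrMatrix_entry_gks Kf Cf hK (p := (1 : Fin 3)) (q := 2) (r := 0) (by decide) (by decide) (by decide)
  rw [← hA] at d0 d1 d2 s10 s20 s21 g01 g02 g12
  have h01 : A 0 2 * A 1 2 ≤ A 0 1 := by rw [← s21]; exact g01
  have h02 : A 0 1 * A 1 2 ≤ A 0 2 := g02
  have h12 : A 0 1 * A 0 2 ≤ A 1 2 := by rw [← s10]; exact g12
  rw [Matrix.inv_def, Ring.inverse_eq_inv', Matrix.adjugate_fin_three]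
  fin_cases x <;> fin_cases y <;> simp at hxy ⊢ <;> simp only [d0, d1, d2, s10, s20, s21] <;>
    exact mul_nonpos_of_nonneg_of_nonpos hdinv (by nlinarith [h01, h02, h12])


/-- **The crux holds on two sites**: `Σ = !![1, c; c, 1]` with `c = ⟨σ₀σ₁⟩ ≥ 0` (GKS I) and
`det Σ = 1 - c² > 0`, so `(Σ⁻¹)₀₁ = (Σ⁻¹)₁₀ = -c/(1-c²) ≤ 0`. [folklore] -/
theorem inverseM_two (Kf : Fin m → ℝ) (Cf : Fin m → Finset (Fin 2)) (hK : ∀ i, 0 ≤ Kf i)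
    (x y : Fin 2) (hxy : x ≠ y) : (corrMatrix 2 m Kf Cf)⁻¹ x y ≤ 0 := by
  have hdet := corrMatrix_det_pos Kf Cf
  have hdinv : 0 ≤ ((corrMatrix 2 m Kf Cf).det)⁻¹ := (inv_pos.mpr hdet).le
  set A := corrMatrix 2 m Kf Cf with hA
  have h01 : 0 ≤ A 0 1 := by
    rw [hA, corrMatrix_offdiag Kf Cf (show (0 : Fin 2) ≠ 1 by decide)]
    exact gksExpect_spinProduct_nonneg _ _ _ (fun i _ => hK i) _
  have s10 := corrMatrix_symm Kf Cf (1 : Fin 2) 0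
  rw [← hA] at s10
  have h10 : 0 ≤ A 1 0 := s10 ▸ h01
  have p01 := mul_nonneg hdinv h01
  have p10 := mul_nonneg hdinv h10
  rw [Matrix.inv_def, Ring.inverse_eq_inv', Matrix.adjugate_fin_two]
  fin_cases x <;> fin_cases y <;> simp at hxy ⊢ <;> nlinarith [p01, p10]

/-- **No counterexample on `n ≤ 3` sites** (any number of bonds, any nonnegative couplings):
`n = 0, 1` have no pair `x ≠ y`; `n = 2` is `inverseM_two`; `n = 3` is `inverseM_three`. [folklore] -/
theorem inverseM_of_le_three {n : ℕ} (hn : n ≤ 3) (Kf : Fin m → ℝ) (Cf : Fin m → Finset (Fin n))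
    (hK : ∀ i, 0 ≤ Kf i) (x y : Fin n) (hxy : x ≠ y) : (corrMatrix n m Kf Cf)⁻¹ x y ≤ 0 := by
  interval_cases n
  · exact (Fin.elim0 x)
  · exact absurd (Subsingleton.elim x y) hxy
  · exact inverseM_two Kf Cf hK x y hxy
  · exact inverseM_three Kf Cf hK x y hxy

end Positive

/-! ## Enumeration of spin configurations on four sites (used by (b) and (c)) -/

section Enumeration

/-- `∑_{ω : Fin 4 → ℤˣ} F ω` as a fourfold sum over `ℤˣ`. [folklore] -/
private lemma sum_cfg4 (F : SpinConfig (Fin 4) → ℝ) :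
    ∑ ω, F ω = ∑ a : ℤˣ, ∑ b : ℤˣ, ∑ c : ℤˣ, ∑ d : ℤˣ, F ![a, b, c, d] := by
  have step : ∀ (k : ℕ) (G : (Fin (k+1) → ℤˣ) → ℝ),
      ∑ ω, G ω = ∑ a : ℤˣ, ∑ r : Fin k → ℤˣ, G (Fin.cons a r) := by
    intro k G
    rw [← (Fin.consEquiv fun _ : Fin (k+1) => ℤˣ).sum_comp G, Fintype.sum_prod_type]
    rfl
  rw [step 3 F]
  refine Finset.sum_congr rfl fun a _ => ?_
  rw [step 2]
  refine Finset.sum_congr rfl fun b _ => ?_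
  rw [step 1]
  refine Finset.sum_congr rfl fun c _ => ?_
  rw [step 0]
  refine Finset.sum_congr rfl fun d _ => ?_
  rw [Fintype.sum_unique]
  congr 1

/-- `ℤˣ = {1, -1}` as a `Finset`. [folklore] -/
private lemma units_univ : (Finset.univ : Finset ℤˣ) = {1, -1} := by decide

/-- A sum over `ℤˣ` is the sum of the values at `1` and `-1`. [folklore] -/
private lemma sum_units (g : ℤˣ → ℝ) : ∑ u : ℤˣ, g u = g 1 + g (-1) := by
  rw [units_univ, Finset.sum_pair (by decide)]

/-- `exp (log 2) = 2`. [folklore] -/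
private lemma exp_log_two : Real.exp (Real.log 2) = 2 := Real.exp_log (by norm_num)
/-- `exp (log 4) = 4`. [folklore] -/
private lemma exp_log_four : Real.exp (Real.log 4) = 4 := Real.exp_log (by norm_num)

end Enumeration

/-! ## (b) Load-bearing hypothesis: PAIR interactions (`(C i).card = 2`) -/

/-- The crux with `(C i).card = 2` weakened to `Even (C i).card` (general even, i.e. zero-field,
ferromagnets). [folklore] -/
def WithoutPair : Prop :=
  ∀ (n m : ℕ) (K : Fin m → ℝ) (C : Fin m → Finset (Fin n)),
    (∀ i, 0 ≤ K i) → (∀ i, Even (C i).card) → ∀ x y : Fin n, x ≠ y → (corrMatrix n m K C)⁻¹ x y ≤ 0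

section FourBody

/-- couplings of the four-body witness: all `log 2`. -/
private def K4 : Fin 3 → ℝ := fun _ => Real.log 2
/-- interaction sets of the four-body witness: bonds `{0,1}`, `{1,2}` and the plaquette `{0,1,2,3}`. -/
private def C4 : Fin 3 → Finset (Fin 4) := ![{0, 1}, {1, 2}, Finset.univ]

/-- Boltzmann weight of the four-body witness as a product of three exponentials. [folklore] -/
private lemma weight4 (ω : SpinConfig (Fin 4)) : gksWeight Finset.univ K4 C4 ω =
    Real.exp (Real.log 2 * (spinAt 0 ω * spinAt 1 ω)) * Real.exp (Real.log 2 * (spinAt 1 ω * spinAt 2 ω))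
      * Real.exp (Real.log 2 * (spinAt 0 ω * spinAt 1 ω * spinAt 2 ω * spinAt 3 ω)) := by
  simp only [gksWeight, gksHamiltonian, K4, C4, Fin.sum_univ_three, spinProduct, Fin.prod_univ_four,
    Matrix.cons_val_zero, Matrix.cons_val_one, Matrix.cons_val_two, Matrix.head_cons, Matrix.tail_cons,
    Real.exp_add]
  congr 2 <;> simp [Finset.prod_insert, Finset.prod_singleton]

/-- Partition function of the four-body witness: `Z = 125/4`. [folklore] -/
private lemma Z4 : gksSum Finset.univ K4 C4 (fun _ => 1) = 125 / 4 := by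
  simp only [gksSum, weight4, sum_cfg4, sum_units, spinAt, one_mul]
  simp [Real.exp_neg, exp_log_two]
  norm_num

/-- `Σ` of the four-body witness (`t = tanh log 2 = 3/5` on both bonds and on the plaquette):
`Σ = [[1,t,t²,t²],[t,1,t,t³],[t²,t,1,t²],[t²,t³,t²,1]]`. [folklore] -/
private lemma corrMatrix_four : corrMatrix 4 3 K4 C4 =
    !![1, 3/5, 9/25, 9/25; 3/5, 1, 3/5, 27/125; 9/25, 3/5, 1, 9/25; 9/25, 27/125, 9/25, 1] := by
  ext p q
  fin_cases p <;> fin_cases q <;>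
  · simp only [corrMatrix, Matrix.of_apply, gksExpect, Z4]
    simp only [gksSum, weight4, sum_cfg4, sum_units, spinAt]
    simp [Real.exp_neg, exp_log_two]
    norm_num

/-- `Σ⁻¹` of the four-body witness, certified by `B * Σ = 1`. [folklore] -/
private lemma inv_four : (corrMatrix 4 3 K4 C4)⁻¹ = (1 / 12304 : ℝ) •
    !![21250, -12750, 2025, -5625; -12750, 26875, -12750, 3375;
       2025, -12750, 21250, -5625; -5625, 3375, -5625, 15625] := by
  rw [corrMatrix_four]
  apply Matrix.inv_eq_left_inv
  ext i j
  fin_cases i <;> fin_cases j <;> simp [Matrix.mul_apply, Fin.sum_univ_four] <;> norm_num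

end FourBody

/-- **Any proof must use that the interactions are PAIR interactions.**  Witness (`n = 4`): bonds
`{0,1}`, `{1,2}` and one four-body plaquette `{0,1,2,3}`, all couplings `log 2 ≥ 0`; then
`(Σ⁻¹)₁₃ = 3375/12304 > 0` (also `(Σ⁻¹)₀₂ = 2025/12304 > 0`).  Mechanism: the best linear
predictor of `σ₀σ₁σ₂` on the path is `t σ₀ - t² σ₁ + t σ₂` (negative middle weight) and
`E[σ₃ | rest] = tanh(J) σ₀σ₁σ₂` has a POSITIVE cubic coefficient, whereas for pair interactions
the cubic Walsh coefficients of `tanh(Σ Kᵢσᵢ)` over three neighbours are negative.  Consequently no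
correlation inequality valid for all even ferromagnets implies IM. [folklore] -/
theorem inverseM_false_without_pair : ¬ WithoutPair := by
  intro h
  have hK : ∀ i : Fin 3, 0 ≤ K4 i := fun i => Real.log_nonneg (by norm_num)
  have hC : ∀ i : Fin 3, Even (C4 i).card := by
    intro i; fin_cases i <;> simp [C4, Nat.even_iff]
  have h13 := h 4 3 K4 C4 hK hC 1 3 (by decide)
  rw [inv_four] at h13
  simp at h13
  norm_num at h13

/-! ## (c) Refuted natural strengthening: coupling-antitonicity of `Σ⁻¹` -/

/-- NATURAL STRENGTHENING `S⁺`: off-diagonal entries of `Σ⁻¹` are antitone in every coupling.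
Since `Σ⁻¹ = 1` at `K = 0`, `S⁺` would imply the crux (and is how one would try to prove it via
`d(Σ⁻¹)_{xy}/dK_{uv} = -Cov(L_x L_y, σ_uσ_v)`, `L = Σ⁻¹σ`).  It is FALSE (`not_precisionAntitone`),
although true for `n ≤ 3` and for 92 % of random `(instance, bond, entry)` triples. [folklore] -/
def PrecisionAntitone : Prop :=
  ∀ (n m : ℕ) (K K' : Fin m → ℝ) (C : Fin m → Finset (Fin n)),
    (∀ i, 0 ≤ K i) → (∀ i, K i ≤ K' i) → (∀ i, (C i).card = 2) → ∀ x y : Fin n, x ≠ y →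
      (corrMatrix n m K' C)⁻¹ x y ≤ (corrMatrix n m K C)⁻¹ x y

section Antitone

/-- the six bonds of `K₄`, in the order `01,02,03,12,13,23`. -/
private def C6 : Fin 6 → Finset (Fin 4) := ![{0, 1}, {0, 2}, {0, 3}, {1, 2}, {1, 3}, {2, 3}]
/-- smaller couplings: bond `01` absent (`0`), the other five `log 2`. -/
private def K6 : Fin 6 → ℝ := ![0, Real.log 2, Real.log 2, Real.log 2, Real.log 2, Real.log 2]
/-- larger couplings: bond `01` switched on with `log 4`. -/
private def K6' : Fin 6 → ℝ := ![Real.log 4, Real.log 2, Real.log 2, Real.log 2, Real.log 2, Real.log 2]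

/-- Boltzmann weight for the smaller couplings `K6`. [folklore] -/
private lemma weight6 (ω : SpinConfig (Fin 4)) : gksWeight Finset.univ K6 C6 ω =
    Real.exp (Real.log 2 * (spinAt 0 ω * spinAt 2 ω)) * Real.exp (Real.log 2 * (spinAt 0 ω * spinAt 3 ω))
      * Real.exp (Real.log 2 * (spinAt 1 ω * spinAt 2 ω)) * Real.exp (Real.log 2 * (spinAt 1 ω * spinAt 3 ω))
      * Real.exp (Real.log 2 * (spinAt 2 ω * spinAt 3 ω)) := by
  simp only [gksWeight, gksHamiltonian, K6, C6, Fin.sum_univ_six, spinProduct,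
    Matrix.cons_val_zero, Matrix.cons_val_one, Matrix.cons_val_two, Matrix.head_cons, Matrix.tail_cons,
    Real.exp_add]
  simp [Finset.prod_insert, Finset.prod_singleton]

/-- Boltzmann weight for the larger couplings `K6'`. [folklore] -/
private lemma weight6' (ω : SpinConfig (Fin 4)) : gksWeight Finset.univ K6' C6 ω =
    Real.exp (Real.log 4 * (spinAt 0 ω * spinAt 1 ω))
      * Real.exp (Real.log 2 * (spinAt 0 ω * spinAt 2 ω)) * Real.exp (Real.log 2 * (spinAt 0 ω * spinAt 3 ω))
      * Real.exp (Real.log 2 * (spinAt 1 ω * spinAt 2 ω)) * Real.exp (Real.log 2 * (spinAt 1 ω * spinAt 3 ω))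
      * Real.exp (Real.log 2 * (spinAt 2 ω * spinAt 3 ω)) := by
  simp only [gksWeight, gksHamiltonian, K6', C6, Fin.sum_univ_six, spinProduct,
    Matrix.cons_val_zero, Matrix.cons_val_one, Matrix.cons_val_two, Matrix.head_cons, Matrix.tail_cons,
    Real.exp_add]
  simp [Finset.prod_insert, Finset.prod_singleton]

/-- Partition function for `K6`: `Z = 305/4`. [folklore] -/
private lemma Z6 : gksSum Finset.univ K6 C6 (fun _ => 1) = 305 / 4 := by
  simp only [gksSum, weight6, sum_cfg4, sum_units, spinAt, one_mul]
  simp [Real.exp_neg, exp_log_two]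
  norm_num

/-- Partition function for `K6'`: `Z = 535/2`. [folklore] -/
private lemma Z6' : gksSum Finset.univ K6' C6 (fun _ => 1) = 535 / 2 := by
  simp only [gksSum, weight6', sum_cfg4, sum_units, spinAt, one_mul]
  simp [Real.exp_neg, exp_log_two, exp_log_four]
  norm_num

/-- `Σ` for `K6` (note `(Σ⁻¹)₀₁ = 0`: `{2,3}` is a 2-separator). [folklore] -/
private lemma corrMatrix_six : corrMatrix 4 6 K6 C6 =
    !![1, 45/61, 51/61, 51/61; 45/61, 1, 51/61, 51/61; 51/61, 51/61, 1, 273/305; 51/61, 51/61, 273/305, 1] := by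
  ext p q
  fin_cases p <;> fin_cases q <;>
  · simp only [corrMatrix, Matrix.of_apply, gksExpect, Z6]
    simp only [gksSum, weight6, sum_cfg4, sum_units, spinAt]
    simp [Real.exp_neg, exp_log_two]
    norm_num

/-- `Σ` for `K6'`. [folklore] -/
private lemma corrMatrix_six' : corrMatrix 4 6 K6' C6 =
    !![1, 105/107, 102/107, 102/107; 105/107, 1, 102/107, 102/107;
       102/107, 102/107, 1, 501/535; 102/107, 102/107, 501/535, 1] := by
  ext p q
  fin_cases p <;> fin_cases q <;>
  · simp only [corrMatrix, Matrix.of_apply, gksExpect, Z6']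
    simp only [gksSum, weight6', sum_cfg4, sum_units, spinAt]
    simp [Real.exp_neg, exp_log_two, exp_log_four]
    norm_num

/-- `Σ⁻¹` for `K6`, certified by `B * Σ = 1`. [folklore] -/
private lemma inv_six : (corrMatrix 4 6 K6 C6)⁻¹ = (1 / 18496 : ℝ) •
    !![70516, 0, -31110, -31110; 0, 70516, -31110, -31110;
       -31110, -31110, 120475, -55815; -31110, -31110, -55815, 120475] := by
  rw [corrMatrix_six]
  apply Matrix.inv_eq_left_inv
  ext i j
  fin_cases i <;> fin_cases j <;> simp [Matrix.mul_apply, Fin.sum_univ_four] <;> norm_num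

/-- `Σ⁻¹` for `K6'`, certified by `B * Σ = 1`. [folklore] -/
private lemma inv_six' : (corrMatrix 4 6 K6' C6)⁻¹ = (1 / 98192 : ℝ) •
    !![3097757, -2155515, -463845, -463845; -2155515, 3097757, -463845, -463845;
       -463845, -463845, 1254575, -290505; -463845, -463845, -290505, 1254575] := by
  rw [corrMatrix_six']
  apply Matrix.inv_eq_left_inv
  ext i j
  fin_cases i <;> fin_cases j <;> simp [Matrix.mul_apply, Fin.sum_univ_four] <;> norm_num

end Antitone

/-- **`Σ⁻¹` is not entrywise antitone in the couplings** (so IM cannot be proved bond-by-bond by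
monotonicity / integration in `β`).  Witness `n = 4`: `K₄` minus the bond `01`, couplings `log 2`;
switching the bond `01` on with coupling `log 4` moves `(Σ⁻¹)₂₃` from `-55815/18496 ≈ -3.018` UP
to `-290505/98192 ≈ -2.959`.  (For `n ≤ 3` antitonicity holds; numerically 8 % of random
`(instance, bond, entry)` triples at `n ≤ 7` have the wrong-way derivative
`-Cov(L_xL_y, σ_uσ_v) > 0`, `py/mono.py`.) [folklore] -/
theorem not_precisionAntitone : ¬ PrecisionAntitone := by
  intro h
  have hlog2 : 0 ≤ Real.log 2 := Real.log_nonneg (by norm_num)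
  have hlog4 : 0 ≤ Real.log 4 := Real.log_nonneg (by norm_num)
  have hK : ∀ i : Fin 6, 0 ≤ K6 i := by
    intro i; fin_cases i <;> simp [K6, hlog2]
  have hKK' : ∀ i : Fin 6, K6 i ≤ K6' i := by
    intro i; fin_cases i <;> simp [K6, K6', hlog4]
  have hC : ∀ i : Fin 6, (C6 i).card = 2 := by
    intro i; fin_cases i <;> simp [C6]
  have h23 := h 4 6 K6 K6' C6 hK hKK' hC 2 3 (by decide)
  rw [inv_six, inv_six'] at h23
  simp at h23
  norm_num at h23

/-- **Tightness: the bound `0` of the crux is attained** whenever `x,y` are separated by two sites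
(here `K₄` minus the bond `01`, couplings `log 2`: `{2,3}` separates `0` from `1` and `(Σ⁻¹)₀₁ = 0`
exactly, while the 3-connected pair `(2,3)` has `(Σ⁻¹)₂₃ = -55815/18496 < 0`).  So no strict or
quantitative strengthening `(Σ⁻¹)_{xy} ≤ -f(⟨σ_xσ_y⟩) < 0` holds on connected graphs. [folklore] -/
theorem inverseM_tight_at_twoSeparator :
    (corrMatrix 4 6 K6 C6)⁻¹ 0 1 = 0 ∧ (corrMatrix 4 6 K6 C6)⁻¹ 2 3 < 0 := by
  rw [inv_six]
  constructor <;> simp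

/-! ## (d) Distilled open cores (documentation; conjectural, NOT used by any theorem)

NEAR-MISS statements are recorded as `def … : Prop` only. -/

/-- **Cubic-predictor sign law (LAW).**  For every zero-field pair ferromagnet, every triple
`T = {a,b,c}` of sites and every site `y ∉ T`, the coefficient of `σ_y` in the `L²`-best linear
predictor of the cubic `σ_aσ_bσ_c` by the single spins is `≤ 0`; equivalently
`E[(σ_T - π_{V∖y} σ_T) σ_y] ≤ 0`; equivalently the nonlinear part of `E[σ_y | rest] = tanh(h_y)`
(after removing its best linear approximation) is non-positively correlated with every cubic not
containing `y`.  FACTS: (1) IM ⟹ LAW (attach a weak degree-3 probe `x` to `T`: `(Σ⁻¹)_{xy}` has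
the sign of `κ_T · c_y(T)` with `κ_T < 0`); (2) LAW ⟹ IM on all pairs `(x,y)` with `deg x = 3`,
`y ∉ ∂x` (star–triangle decimation keeps the model a pair ferromagnet); (3) the leading
high-temperature order of `c_y(T)` is the Lebowitz combination
`⟨σ_Tσ_y⟩ - Σ_{a∈T} ⟨σ_{T∖a}⟩⟨σ_aσ_y⟩ = u₄(a,b,c,y) ≤ 0`; (4) 0 violations in 11 752 (|T| = 3) and
5 891 (|T| = 5, same sign) random instances, `n ≤ 8` (`py/law5.py`).  Stated on the crux's own
carrier: `c_y(T) = (Σ⁻¹ v_T)_y`, `v_T(w) = ⟨σ_Tσ_w⟩`. [folklore] -/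
def CubicPredictorLaw : Prop :=
  ∀ (n m : ℕ) (K : Fin m → ℝ) (C : Fin m → Finset (Fin n)), (∀ i, 0 ≤ K i) → (∀ i, (C i).card = 2) →
    ∀ (a b c y : Fin n), a ≠ b → b ≠ c → a ≠ c → y ≠ a → y ≠ b → y ≠ c →
      ((corrMatrix n m K C)⁻¹).mulVec
        (fun w => gksExpect Finset.univ K C (fun ω => spinAt a ω * spinAt b ω * spinAt c ω * spinAt w ω)) y ≤ 0

/-- **Triple partial-covariance law (Law₂)** — the doubly-decimated form: for every zero-field pair
ferromagnet and all triples `S, S'` of sites, the partial covariance of `σ_S` and `σ_{S'}` given the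
linear span of all single spins is `≥ 0`:
`⟨σ_Sσ_{S'}⟩ ≥ v_Sᵀ Σ⁻¹ v_{S'}`, `v_S(w) = ⟨σ_Sσ_w⟩`.  LAW for a degree-3 site `y` (∂y = S) is
Law₂ for `(S, T)` in the decimated model; IM for two non-adjacent degree-3 sites is Law₂ for their
neighbourhoods.  For `S = S'` trivial; for `|S ∩ S'| = 2` the leading order is GKS II. No
counterexample known. [folklore] -/
def TriplePartialCovLaw : Prop :=
  ∀ (n m : ℕ) (K : Fin m → ℝ) (C : Fin m → Finset (Fin n)), (∀ i, 0 ≤ K i) → (∀ i, (C i).card = 2) →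
    ∀ (S S' : Finset (Fin n)), S.card = 3 → S'.card = 3 →
      (dotProduct (fun w => gksExpect Finset.univ K C (fun ω => spinProduct S ω * spinAt w ω))
        (((corrMatrix n m K C)⁻¹).mulVec
          (fun w => gksExpect Finset.univ K C (fun ω => spinProduct S' ω * spinAt w ω))))
      ≤ gksExpect Finset.univ K C (fun ω => spinProduct S ω * spinProduct S' ω)

end

end Summit.CriticalPhenomena.Ising3DConformalLimit.Cruxes.InverseMFerromagnet.Disproof
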